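import Literature.RepresentationTheory.Kovacevic2021.SU21SubquotientData
import Literature.Algebra.Lie.LieModuleFirstIsomorphism
import HarnessLib

/-!
# The module of a subquotient datum is the subquotient module `N₂ ⧸ (N₁ ⊓ N₂)`

Continuation of `…Kovacevic2021.SU21SubquotientData` (for two Lie submodules `N₁, N₂` of the `𝔤𝔩(3,ℂ)`-module
`𝒟.V` of a datum `𝒟 : SU21Datum`, the subquotient datum `𝒟.subquotient N₁ N₂` on the `K`-types met by `N₂` and
not by `N₁`, with the arrow coefficients of `𝒟` between them) [Kovacevic2021, §3 Thm 1, Thm 2, Remarks 2, 3, 6].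

Here: **restricting coefficient functions to the labels over `sqSet` is a SURJECTIVE morphism of Lie modules
`sqHom : N₂ → (𝒟.subquotient N₁ N₂).V` with kernel `N₁ ⊓ N₂`**, hence an isomorphism of `𝔤𝔩(3,ℂ)`-modules
`sqEquiv : N₂ ⧸ ker ≃ (𝒟.subquotient N₁ N₂).V` — Kovačević's "submodule, quotient or subquotient"
[§3 Remark 6] as honest modules.  The point of the intertwining (`sqProj_lie`): on a basis vector `u^k_{n,m}` with
`u^1_{n,m} ∈ N₂` the action of `𝒟` and of the subquotient datum differ only by arrow terms landing outside
`sqSet`, i.e. in `K`-types not met by `N₂` (dead arrows, by arrow-closedness) or met by `N₁` (killed by the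
restriction) (`coef_smul_vec_eq`).

## What is here

* (from `Literature.Algebra.Lie.LieModuleFirstIsomorphism`: `lieModuleEquivOfBijective`, `lieQuotKerEquivOfSurjective`
  — the first isomorphism theorem `M ⧸ ker f ≃ₗ⁅R,L⁆ P` for Lie modules, Humphreys 1972 §6.1.)
* §1 DEFINITIONS `sqIncl` (labels of the subquotient ↪ labels of `𝒟`), `sqProj : 𝒟.V →ₗ[ℂ] (subquotient).V`
  (restriction), THEOREMS `sqProj_apply`, `sqProj_vec`, `coef_smul_vec_eq`, **`sqProj_lie`**.
* §2 DEFINITION **`sqHom`**, THEOREMS `sqHom_surjective`, **`mem_ker_sqHom_iff`** (`x ∈ ker ↔ x ∈ N₁`), `ker_sqHom`,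
  DEFINITION **`sqEquiv`**; special cases `sqHom_injective_of_eq_bot` (sub-datum, `N₁ = ⊥`: `N₂ ≃ (sub-datum).V`,
  `sqEquivOfBot`).

## References

* D. Kovačević, *Unitary `(𝔤,K)` modules of `SU(2,1)`*, Acta Math. Spalatensia 1 (2021) 105–125
  (arXiv:1810.01752): §3 Thm 1, Thm 2, Remarks 2, 3, 6. [Kovacevic2021]
* A. Borel, N. Wallach (2000), VI 4.10 (10) p. 132. [BorelWallach2000]
-/

noncomputable section

open Finsupp

namespace Literature.RepresentationTheory.Kovacevic2021

-- Mathlib idiom (Mathlib/Algebra/Lie/OfAssociative.lean): commutator brackets on associative algebras; needed for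
-- the `𝔤𝔩(3,ℂ)`-module structure on `𝒟.V`, as in every file of this directory.
attribute [local instance 100] LieRing.ofAssociativeRing

open Literature.Algebra.Lie

namespace SU21Datum

variable (𝒟 : SU21Datum) (N₁ N₂ : LieSubmodule ℂ (Matrix (Fin 3) (Fin 3) ℂ) 𝒟.V)

/-! ## §1 Restriction of coefficient functions to the labels of the subquotient -/

/-- the basis labels of the subquotient datum are basis labels of `𝒟` [cite: Kovacevic2021, §3 Def 1] -/
def sqIncl : (𝒟.subquotient N₁ N₂).Idx → 𝒟.Idx := fun t => ⟨t.1, t.2.1.1, t.2.2⟩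

/-- `sqIncl` is injective [cite: Kovacevic2021, §3 Def 1] -/
theorem sqIncl_injective : Function.Injective (𝒟.sqIncl N₁ N₂) := by
  intro a b h
  have h' : (𝒟.sqIncl N₁ N₂ a).1 = (𝒟.sqIncl N₁ N₂ b).1 := congrArg Subtype.val h
  exact Subtype.ext h'

/-- **Restriction** of a finitely supported coefficient function on the labels of `𝒟` to the labels of the
subquotient (a `ℂ`-linear map `𝒟.V → (𝒟.subquotient N₁ N₂).V`). [cite: Kovacevic2021, §3 Def 1, Remark 6] -/
def sqProj : 𝒟.V →ₗ[ℂ] (𝒟.subquotient N₁ N₂).V :=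
  Finsupp.lcomapDomain (𝒟.sqIncl N₁ N₂) (𝒟.sqIncl_injective N₁ N₂)

variable {𝒟 N₁ N₂}

/-- `sqProj x` is `x` read on the labels of the subquotient [cite: Kovacevic2021, §3 Def 1] -/
@[simp] theorem sqProj_apply (x : 𝒟.V) (t : (𝒟.subquotient N₁ N₂).Idx) : 𝒟.sqProj N₁ N₂ x t = x (𝒟.sqIncl N₁ N₂ t) := by
  simp [sqProj]

/-- **`sqProj` on the basis**: `u^k_{n,m} ↦ u^k_{n,m}` (which is `0` in the subquotient unless `(n,m) ∈ sqSet`).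
[cite: Kovacevic2021, §3 Def 1, Remark 6] -/
theorem sqProj_vec (n m k : ℤ) : 𝒟.sqProj N₁ N₂ (𝒟.vec n m k) = (𝒟.subquotient N₁ N₂).vec n m k := by
  ext ⟨⟨n', m', k'⟩, ht⟩
  rw [sqProj_apply]
  by_cases h' : (n, m) ∈ (𝒟.subquotient N₁ N₂).S ∧ 1 ≤ k ∧ k ≤ n
  · rw [vec_of_pos n m k h', vec_of_pos n m k ⟨h'.1.1, h'.2⟩]
    simp only [Finsupp.single_apply, sqIncl, Subtype.mk.injEq]
  · rw [vec_of_neg n m k h']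
    by_cases h : (n, m) ∈ 𝒟.S ∧ 1 ≤ k ∧ k ≤ n
    · rw [vec_of_pos n m k h, Finsupp.single_apply, Finsupp.zero_apply, if_neg]
      intro heq
      have heq' := congrArg Subtype.val heq
      simp only [sqIncl, Prod.mk.injEq] at heq'
      obtain ⟨rfl, rfl, rfl⟩ := heq'
      exact h' ⟨ht.1, h.2⟩
    · rw [vec_of_neg n m k h, Finsupp.zero_apply, Finsupp.zero_apply]

/-- **The arrow terms agree after restriction.** If `u^1_{n,m} ∈ N₂`, then for every direction `δ` and every `j`,
`coef_δ(n,m) · u^j_{(n,m)+δ} = sqCoef_δ(n,m) · u^j_{(n,m)+δ}` in the subquotient: either the target is not in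
`sqSet` (both sides `0`), or `(n,m) ∈ sqSet` (same coefficient), or `u^1_{n,m} ∈ N₁` / `(n,m) ∉ S` and then the
arrow of `𝒟` is dead (arrow-closedness of the `K`-types of `N₁`). [cite: Kovacevic2021, §3 Thm 1, Remark 2, Remark 6] -/
theorem coef_smul_vec_eq (δ : Dir) {n m : ℤ} (h2 : 𝒟.vec n m 1 ∈ N₂) (j : ℤ) :
    𝒟.coef δ n m • (𝒟.subquotient N₁ N₂).vec (δ.shift (n, m)).1 (δ.shift (n, m)).2 j =
      𝒟.sqCoef N₁ N₂ δ n m • (𝒟.subquotient N₁ N₂).vec (δ.shift (n, m)).1 (δ.shift (n, m)).2 j := by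
  by_cases hy : δ.shift (n, m) ∈ 𝒟.sqSet N₁ N₂
  · by_cases hx : (n, m) ∈ 𝒟.sqSet N₁ N₂
    · rw [sqCoef_of_mem hx hy]
    · rw [sqCoef_of_not_mem_src hx, zero_smul]
      suffices hc : 𝒟.coef δ n m = 0 by rw [hc, zero_smul]
      by_contra hc
      have hS : (n, m) ∈ 𝒟.S := mem_of_coef_ne_zero δ hc
      have h1 : 𝒟.vec n m 1 ∈ N₁ := by
        by_contra h1
        exact hx ⟨hS, h2, h1⟩
      exact hy.2.2 (vec_one_shift_mem_of_coef_ne_zero N₁ δ h1 hc)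
  · have : (𝒟.subquotient N₁ N₂).vec (δ.shift (n, m)).1 (δ.shift (n, m)).2 j = 0 := vec_of_not_mem j hy
    rw [this, smul_zero, smul_zero]

/-- **The restriction intertwines the two actions on `N₂`, basis case**: for `u^1_{n,m} ∈ N₂`,
`sqProj ⁅M, u^k_{n,m}⁆ = ⁅M, u^k_{n,m}⁆` (the latter in the subquotient datum). [cite: Kovacevic2021, §3 Thm 1, Remark 6] -/
theorem sqProj_lie_vec (M : Matrix (Fin 3) (Fin 3) ℂ) {n m : ℤ} (h2 : 𝒟.vec n m 1 ∈ N₂) (k : ℤ) :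
    𝒟.sqProj N₁ N₂ ⁅M, 𝒟.vec n m k⁆ = ⁅M, (𝒟.subquotient N₁ N₂).vec n m k⁆ := by
  rcases lt_or_ge k 1 with hk | hk
  · rw [vec_of_lt_one n m hk, vec_of_lt_one n m hk, lie_zero, lie_zero, map_zero]
  -- the four arrow rewrites, with arbitrary scalar prefactors
  have hA : ∀ (c : ℂ) (j : ℤ), (c * 𝒟.A n m) • (𝒟.subquotient N₁ N₂).vec (n + 1) (m + 3) j =
      (c * (𝒟.subquotient N₁ N₂).A n m) • (𝒟.subquotient N₁ N₂).vec (n + 1) (m + 3) j := fun c j => by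
    rw [mul_smul, mul_smul]; exact congrArg (c • ·) (coef_smul_vec_eq Dir.A h2 j)
  have hB : ∀ (c : ℂ) (j : ℤ), (c * 𝒟.B n m) • (𝒟.subquotient N₁ N₂).vec (n + 1) (m - 3) j =
      (c * (𝒟.subquotient N₁ N₂).B n m) • (𝒟.subquotient N₁ N₂).vec (n + 1) (m - 3) j := fun c j => by
    rw [mul_smul, mul_smul]; exact congrArg (c • ·) (coef_smul_vec_eq Dir.B h2 j)
  have hC : ∀ (c : ℂ) (j : ℤ), (c * 𝒟.C n m) • (𝒟.subquotient N₁ N₂).vec (n - 1) (m + 3) j =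
      (c * (𝒟.subquotient N₁ N₂).C n m) • (𝒟.subquotient N₁ N₂).vec (n - 1) (m + 3) j := fun c j => by
    rw [mul_smul, mul_smul]; exact congrArg (c • ·) (coef_smul_vec_eq Dir.C h2 j)
  have hD : ∀ (c : ℂ) (j : ℤ), (c * 𝒟.D n m) • (𝒟.subquotient N₁ N₂).vec (n - 1) (m - 3) j =
      (c * (𝒟.subquotient N₁ N₂).D n m) • (𝒟.subquotient N₁ N₂).vec (n - 1) (m - 3) j := fun c j => by
    rw [mul_smul, mul_smul]; exact congrArg (c • ·) (coef_smul_vec_eq Dir.D h2 j)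
  rw [lie_def, lie_def]
  simp only [ρfun, LinearMap.add_apply, LinearMap.smul_apply, map_add, map_smul, map_neg, Ha_vec, Hb_vec, Xa_vec,
    Ya_vec _ _ hk, Xab_vec, Xb_vec _ _ hk, Yab_vec _ _ hk, Yb_vec, smul_add, smul_neg, smul_smul, sqProj_vec,
    neg_smul, ← mul_assoc, hA, hB, hC, hD]

/-- **The restriction intertwines the two actions on `N₂`**: `sqProj ⁅M, v⁆ = ⁅M, sqProj v⁆` for `v ∈ N₂`.
[cite: Kovacevic2021, §3 Thm 1, Remark 2, Remark 6] -/
theorem sqProj_lie (M : Matrix (Fin 3) (Fin 3) ℂ) {v : 𝒟.V} (hv : v ∈ N₂) :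
    𝒟.sqProj N₁ N₂ ⁅M, v⁆ = ⁅M, 𝒟.sqProj N₁ N₂ v⁆ := by
  have hv' : v ∈ Finsupp.supported ℂ ℂ {t : 𝒟.Idx | 𝒟.vec t.1.1 t.1.2.1 1 ∈ N₂} := by
    rw [← toSubmodule_eq_supported N₂]; exact hv
  rw [Finsupp.supported_eq_span_single] at hv'
  refine Submodule.span_induction (p := fun v _ => 𝒟.sqProj N₁ N₂ ⁅M, v⁆ = ⁅M, 𝒟.sqProj N₁ N₂ v⁆) ?_
    (by rw [lie_zero, map_zero, lie_zero]) (fun x y _ _ hx hy => by rw [lie_add, map_add, hx, hy, map_add, lie_add])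
    (fun c x _ hx => by rw [lie_smul, map_smul, hx, map_smul, lie_smul]) hv'
  rintro _ ⟨t, ht, rfl⟩
  obtain ⟨⟨n, m, k⟩, h⟩ := t
  have ht' : 𝒟.vec n m 1 ∈ N₂ := ht
  have e : Finsupp.single (⟨(n, m, k), h⟩ : 𝒟.Idx) (1 : ℂ) = 𝒟.vec n m k := (vec_of_pos n m k h).symm
  dsimp only
  rw [e, sqProj_vec]
  exact sqProj_lie_vec M ht' k

variable (𝒟 N₁ N₂)

/-! ## §2 The surjection `N₂ → (subquotient).V`, its kernel, and the isomorphism -/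

/-- **The restriction `N₂ → (𝒟.subquotient N₁ N₂).V` as a morphism of `𝔤𝔩(3,ℂ)`-modules.**
[cite: Kovacevic2021, §3 Remark 6] -/
def sqHom : N₂ →ₗ⁅ℂ, Matrix (Fin 3) (Fin 3) ℂ⁆ (𝒟.subquotient N₁ N₂).V :=
  { 𝒟.sqProj N₁ N₂ ∘ₗ (N₂ : Submodule ℂ 𝒟.V).subtype with
    map_lie' := by
      intro M x
      change 𝒟.sqProj N₁ N₂ ((⁅M, x⁆ : N₂) : 𝒟.V) = ⁅M, 𝒟.sqProj N₁ N₂ (x : 𝒟.V)⁆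
      rw [LieSubmodule.coe_bracket]
      exact sqProj_lie M x.2 }

variable {𝒟 N₁ N₂}

/-- `sqHom x = sqProj x` [cite: Kovacevic2021, §3 Remark 6] -/
@[simp] theorem sqHom_apply (x : N₂) : 𝒟.sqHom N₁ N₂ x = 𝒟.sqProj N₁ N₂ (x : 𝒟.V) := rfl

/-- a coefficient function on the labels of the subquotient, extended by zero, lies in `N₂` [cite: Kovacevic2021, §3 Remark 2] -/
theorem mapDomain_sqIncl_mem (w : (𝒟.subquotient N₁ N₂).V) : Finsupp.mapDomain (𝒟.sqIncl N₁ N₂) w ∈ N₂ := by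
  classical
  rw [mem_iff_forall_support]
  intro t ht
  obtain ⟨t', -, rfl⟩ := Finset.mem_image.1 (Finsupp.mapDomain_support ht)
  exact t'.2.1.2.1

/-- **`sqHom` is surjective** (extend by zero, then restrict). [cite: Kovacevic2021, §3 Remark 6] -/
theorem sqHom_surjective : Function.Surjective (𝒟.sqHom N₁ N₂) := fun w =>
  ⟨⟨Finsupp.mapDomain (𝒟.sqIncl N₁ N₂) w, mapDomain_sqIncl_mem w⟩,
    Finsupp.leftInverse_lcomapDomain_mapDomain (R := ℂ) _ (𝒟.sqIncl_injective N₁ N₂) w⟩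

/-- **The kernel of `sqHom` is `N₁ ⊓ N₂`**: for `x ∈ N₂`, `sqHom x = 0 ↔ x ∈ N₁` (a member of `N₂` restricts to
zero iff every `K`-type it meets is met by `N₁`). [cite: Kovacevic2021, §3 Remark 2, Remark 6] -/
theorem mem_ker_sqHom_iff (x : N₂) : x ∈ (𝒟.sqHom N₁ N₂).ker ↔ (x : 𝒟.V) ∈ N₁ := by
  rw [LieModuleHom.mem_ker, sqHom_apply]
  constructor
  · intro h0
    rw [mem_iff_forall_support]
    intro t ht
    by_contra h1
    have hT : (t.1.1, t.1.2.1) ∈ 𝒟.sqSet N₁ N₂ := ⟨t.2.1, (mem_iff_forall_support N₂ _).1 x.2 t ht, h1⟩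
    have key := DFunLike.congr_fun h0 ⟨t.1, hT, t.2.2⟩
    rw [sqProj_apply, Finsupp.zero_apply] at key
    exact Finsupp.mem_support_iff.1 ht key
  · intro h1
    ext t
    rw [sqProj_apply, Finsupp.zero_apply]
    by_contra h
    have ht : 𝒟.sqIncl N₁ N₂ t ∈ (x : 𝒟.V).support := Finsupp.mem_support_iff.2 h
    exact t.2.1.2.2 ((mem_iff_forall_support N₁ _).1 h1 _ ht)

/-- the kernel of `sqHom` is `N₁` pulled back to `N₂` [cite: Kovacevic2021, §3 Remark 6] -/
theorem ker_sqHom : (𝒟.sqHom N₁ N₂).ker = N₁.comap N₂.incl := by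
  ext x
  rw [mem_ker_sqHom_iff, LieSubmodule.mem_comap, LieSubmodule.incl_apply]

variable (𝒟 N₁ N₂)

/-- **The module of the subquotient datum is the subquotient module**: `N₂ ⧸ (N₁ ⊓ N₂) ≃ (𝒟.subquotient N₁ N₂).V`
as `𝔤𝔩(3,ℂ)`-modules (the quotient is by `ker sqHom = N₁.comap N₂.incl`, see `ker_sqHom`).
[cite: Kovacevic2021, §3 Remark 6] [cite: BorelWallach2000, VI 4.10 (10)] -/
def sqEquiv : (N₂ ⧸ (𝒟.sqHom N₁ N₂).ker) ≃ₗ⁅ℂ, Matrix (Fin 3) (Fin 3) ℂ⁆ (𝒟.subquotient N₁ N₂).V :=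
  lieQuotKerEquivOfSurjective (𝒟.sqHom N₁ N₂) sqHom_surjective

variable {𝒟 N₁ N₂}

/-- `sqEquiv` on the class of `x ∈ N₂` is the restriction of `x` [cite: Kovacevic2021, §3 Remark 6] -/
@[simp] theorem sqEquiv_mk (x : N₂) :
    𝒟.sqEquiv N₁ N₂ (LieSubmodule.Quotient.mk' _ x) = 𝒟.sqProj N₁ N₂ (x : 𝒟.V) :=
  lieQuotKerEquivOfSurjective_mk _ _ x

/-- **Sub-datum**: for `N₁ = ⊥` the restriction `N₂ → (𝒟.subquotient ⊥ N₂).V` is injective, so bijective.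
[cite: Kovacevic2021, §3 Remark 6 ("submodule")] -/
theorem sqHom_bijective_of_eq_bot (h : N₁ = ⊥) : Function.Bijective (𝒟.sqHom N₁ N₂) := by
  refine ⟨?_, sqHom_surjective⟩
  rw [← LieModuleHom.ker_eq_bot, LieSubmodule.eq_bot_iff]
  intro x hx
  rw [mem_ker_sqHom_iff, h, LieSubmodule.mem_bot] at hx
  exact Subtype.ext hx

variable (𝒟 N₂) in
/-- **The module of a sub-datum is the submodule**: `N₂ ≃ (𝒟.subquotient ⊥ N₂).V` as `𝔤𝔩(3,ℂ)`-modules.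
[cite: Kovacevic2021, §3 Remark 6 ("submodule")] -/
def sqEquivOfBot : N₂ ≃ₗ⁅ℂ, Matrix (Fin 3) (Fin 3) ℂ⁆ (𝒟.subquotient ⊥ N₂).V :=
  lieModuleEquivOfBijective (𝒟.sqHom ⊥ N₂) (sqHom_bijective_of_eq_bot rfl)

/-- the `K`-types of the sub-datum of `N₂` are the `K`-types met by `N₂` [cite: Kovacevic2021, §3 Remark 2] -/
theorem mem_sqSet_bot_iff {n m : ℤ} : (n, m) ∈ 𝒟.sqSet ⊥ N₂ ↔ (n, m) ∈ 𝒟.S ∧ 𝒟.vec n m 1 ∈ N₂ := by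
  rw [mem_sqSet_iff, LieSubmodule.mem_bot]
  exact ⟨fun h => ⟨h.1, h.2.1⟩, fun h => ⟨h.1, h.2, vec_ne_zero ⟨h.1, le_rfl, 𝒟.one_le_of_mem h.1⟩⟩⟩

/-- the `K`-types of the quotient datum `𝒟.V ⧸ N₁` are the `K`-types NOT met by `N₁` [cite: Kovacevic2021, §3 Remark 6] -/
theorem mem_sqSet_top_iff {n m : ℤ} : (n, m) ∈ 𝒟.sqSet N₁ ⊤ ↔ (n, m) ∈ 𝒟.S ∧ 𝒟.vec n m 1 ∉ N₁ := by
  rw [mem_sqSet_iff]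
  exact ⟨fun h => ⟨h.1, h.2.2⟩, fun h => ⟨h.1, LieSubmodule.mem_top _, h.2⟩⟩

end SU21Datum

end Literature.RepresentationTheory.Kovacevic2021
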